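import Literature.Uncategorized.Crux
import Literature.Topology.FourManifolds.Rasmussen
import Literature.Topology.FourManifolds.LeeRasmussen
import Literature.Topology.FourManifolds.GaussDiagramsRegularPosition
import Literature.Barriers.SmoothPoincare4.GluckTwistsDissolve
import HarnessLib

/-!
# `ZseCruxRasmussen` — negative knowledge V: homotopy-ball-blind invariants cannot witness; the friend lemma (τ-filter)

Refuter support lemmas for crux `stmt-SmoothPoincare4-0366` (`Literature.Uncategorized.Crux`: knots `K, K'` with a
common `0`-surgery `Y`, `K` smoothly slice, `s(K') ≠ 0`), from the standing disprover's work file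
`Summits/SmoothPoincare4/SmoothPoincare4/Cruxes/ZseCruxRasmussen/Disproof.lean` §9 (cycle 3).  The technique class
enters as an abstract knot-invariant predicate `ι : Knot → ℤ → Prop` with the spelled-out hypothesis
`hι : ∀ K v, K.IsHomotopyBallSlice → ι K v → v = 0` ("`ι` is BLIND on homotopy 4-balls"); printed members:
Ozsváth–Szabó's `τ` (Thm. 1.1 with `b₂⁺ = b₁ = 0`; FGMW 2010 §1 p. 4: "if `K` is slice in any homotopy 4-ball, then
`τ(K) = 0`"), every knot-Floer concordance invariant, the `s♯`-bound (KM 2013 Cor. 1.1), branched-cover /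
`d`-invariant obstructions to bounding an equivariant `ℤ/2`-homology ball, and every topological concordance
invariant (Freedman).  NOT known blind: Rasmussen's `s` — MMSW Question 9.11.  No definitions; no route item is
concluded positively.

* `blind_eq_zero_on_partner` — a blind `ι` vanishes on the partner `K'` of every `0`-surgery pair with `K` slice
  (Manolescu–Piccirillo Lemma 3.3, PROVED as `Literature.Uncategorized.isHomotopyBallSlice_of_zeroSurgeryPair`);
* `crux_blindWitness_false` — the crux with its witness clause read through ANY blind invariant is FALSE;
* `isHomotopyBallBlind_rasmussen_iff_mmsw2023Question911Knot` — "`s` is blind" IS MMSW Q9.11 (definitional), and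
  `not_crux_of_rasmussen_blind` — blindness of `s` kills the crux (the technique-class form of `not_crux_of_mmsw911`);
* `not_isSmoothlySlice_of_zeroSurgeryPair_of_isConcordant_of_blind` — THE FRIEND LEMMA: a `0`-friend `K` of a knot
  `K'` concordant to a knot `K₀` with a NON-ZERO blind, concordance-invariant, everywhere-defined invariant is not
  smoothly slice.  Printed instance (`ι = τ`): Kegel–Spreer, arXiv:2603.22438 (2026), §6.2(1) p. 17 — the
  262-crossing `W₊''` shares its `0`-surgery with `W₊'`, concordant to `W₊ = Wh⁺(T₂,₃)`, `τ(W₊) = 1` (Hedden, Geom.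
  Topol. 11 (2007), Thm. 1.4); "We do not know if `W₊''` is smoothly slice" — it is NOT, by this lemma; as
  `s(W₊) = 2` that pair was the one printed live candidate for this crux with a plain `s ≠ 0` partner;
* `crux_partner_not_isConcordant_of_blind` — the τ-FILTER: the partner of a witness is concordant to no knot carrying
  a non-zero blind invariant (`τ(K') = 0 ≠ s(K')`: the Hedden–Ording regime);
* `not_isSmoothlySlice_of_zeroSurgeryPair_of_isConcordant_of_mmsw911` — the same for `s` itself GIVEN Q9.11 and
  concordance invariance of `s` (Kegel–Spreer's Algorithm 6 form).
References: Ozsváth–Szabó 2003 Thm. 1.1 [OzsvathSzabo2003FourBallGenus]; FGMW 2010 §1 [FreedmanGompfMorrisonWalker2010];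
Manolescu–Piccirillo 2023 Lemma 3.3 [ManolescuPiccirillo2023]; MMSW 2023 Question 9.11 [ManolescuMarengonSarkarWillis2023];
Rasmussen 2010 Thm. 1 [Rasmussen2010]; Kegel–Spreer 2026 §6.2 [KegelSpreer2026]; Hedden 2007 Thm. 1.4.
-/

noncomputable section

set_option linter.dupNamespace false

namespace Summit.SmoothPoincare4.SmoothPoincare4.Theorems.ZseCruxRasmussen.Negative

open scoped Manifold ContDiff
open Literature.Topology.FourManifolds Literature.Barriers.SmoothPoincare4 Literature.Uncategorized

variable {ι : Knot → ℤ → Prop}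

/-- **A homotopy-ball-blind invariant vanishes on the partner of every `0`-surgery pair with `K` slice**: the
partner is slice in a homotopy ball (Manolescu–Piccirillo Lemma 3.3, PROVED). [cite: ManolescuPiccirillo2023, Lemma 3.3]
[cite: FreedmanGompfMorrisonWalker2010, §1 p. 4] -/
theorem blind_eq_zero_on_partner (hι : ∀ (K : Knot) (v : ℤ), K.IsHomotopyBallSlice → ι K v → v = 0)
    {K K' : Knot} {Y : Type} [TopologicalSpace Y] [ChartedSpace (EuclideanSpace ℝ (Fin 3)) Y]
    (hK : IsIntegralSurgery (𝓡 3) Y K 0) (hK' : IsIntegralSurgery (𝓡 3) Y K' 0) (hsl : K.IsSmoothlySlice)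
    {v : ℤ} (hv : ι K' v) : v = 0 :=
  hι K' v (isHomotopyBallSlice_of_zeroSurgeryPair hK hK' hsl) hv

/-- **The crux with its witness clause read through ANY blind invariant is FALSE**: no `0`-surgery pair with `K`
slice has a partner with a non-zero blind invariant — `τ`, `ε`, `ν⁺`, `Υ`, the `s♯`-bound, `d`-invariant and
branched-cover obstructions, signatures and Casson–Gordon invariants can never certify a partner.
[cite: FreedmanGompfMorrisonWalker2010, §1 p. 4] [cite: OzsvathSzabo2003FourBallGenus, Thm. 1.1] -/
theorem crux_blindWitness_false (hι : ∀ (K : Knot) (v : ℤ), K.IsHomotopyBallSlice → ι K v → v = 0) :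
    ¬ ∃ (K K' : Knot) (Y : Type) (_ : TopologicalSpace Y) (_ : ChartedSpace (EuclideanSpace ℝ (Fin 3)) Y)
        (v : ℤ), IsIntegralSurgery (𝓡 3) Y K 0 ∧ IsIntegralSurgery (𝓡 3) Y K' 0 ∧ K.IsSmoothlySlice ∧
          ι K' v ∧ v ≠ 0 := by
  rintro ⟨K, K', Y, _, _, v, hK, hK', hsl, hv, hv0⟩
  exact hv0 (blind_eq_zero_on_partner hι hK hK' hsl hv)

/-- **MMSW Question 9.11 (knots) is precisely "Rasmussen's `s` is blind on homotopy balls"** (definitional).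
[cite: ManolescuMarengonSarkarWillis2023, Question 9.11] -/
theorem isHomotopyBallBlind_rasmussen_iff_mmsw2023Question911Knot :
    (∀ (K : Knot) (v : ℤ), K.IsHomotopyBallSlice → K.HasRasmussenInvariant v → v = 0) ↔
      MMSW2023Question911Knot :=
  ⟨fun h K hK s hs ↦ h K s hK hs, fun h K v hK hv ↦ h K hK v hv⟩

/-- Hence **the crux is exactly the assertion that `s` is NOT blind on `0`-surgery-born homotopy balls**: if `s`
is blind the crux fails (the technique-class form of `not_crux_of_mmsw911`). [cite: ManolescuMarengonSarkarWillis2023, Question 9.11] -/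
theorem not_crux_of_rasmussen_blind
    (h : ∀ (K : Knot) (v : ℤ), K.IsHomotopyBallSlice → K.HasRasmussenInvariant v → v = 0) : ¬ Crux :=
  crux_blindWitness_false h

/-- **THE FRIEND LEMMA.** Let `ι` be blind on homotopy balls (`hι`), a concordance invariant (`hconc`) and defined
on every knot (`hex`). If `Y` is `0`-surgery on `K` and on `K'`, and `K'` is concordant to a knot `K₀` with
`ι(K₀) = v ≠ 0`, then `K` is NOT smoothly slice: otherwise `K'` is slice in a homotopy ball (MP 3.3), so
`ι(K') = 0`, while `ι(K') = ι(K₀) = v` by concordance.  PRINTED INSTANCE (`ι = τ`, blind by Ozsváth–Szabó 2003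
Thm. 1.1, a concordance invariant of every knot): Kegel–Spreer 2026 §6.2(1) — `W₊''` (262 crossings) shares its
`0`-surgery with `W₊'`, concordant to the positive untwisted Whitehead double `W₊` of the right-handed trefoil,
`τ(W₊) = 1` (Hedden 2007 Thm. 1.4); so `W₊''`, whose sliceness is left open there, is not slice.
[cite: OzsvathSzabo2003FourBallGenus, Thm. 1.1] [cite: ManolescuPiccirillo2023, Lemma 3.3] [cite: KegelSpreer2026, §6.2] -/
theorem not_isSmoothlySlice_of_zeroSurgeryPair_of_isConcordant_of_blind
    (hι : ∀ (K : Knot) (v : ℤ), K.IsHomotopyBallSlice → ι K v → v = 0)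
    (hconc : ∀ {K K' : Knot} {v v' : ℤ}, ι K v → ι K' v' → K.IsConcordant K' → v = v')
    (hex : ∀ K : Knot, ∃ v, ι K v)
    {K K' K₀ : Knot} {Y : Type} [TopologicalSpace Y] [ChartedSpace (EuclideanSpace ℝ (Fin 3)) Y]
    (hK : IsIntegralSurgery (𝓡 3) Y K 0) (hK' : IsIntegralSurgery (𝓡 3) Y K' 0)
    (hc : K'.IsConcordant K₀) {v : ℤ} (hv : ι K₀ v) (hv0 : v ≠ 0) : ¬ K.IsSmoothlySlice := by
  intro hsl
  obtain ⟨w, hw⟩ := hex K'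
  exact hv0 ((hconc hw hv hc).symm.trans (blind_eq_zero_on_partner hι hK hK' hsl hw))

/-- **The τ-filter on partners**: in a witness of the crux the partner `K'` is concordant to NO knot carrying a
non-zero value of a blind concordance invariant defined everywhere — with `ι = τ`: `τ(K') = 0` although
`s(K') ≠ 0` (the Hedden–Ording regime `s ≠ 2τ`); positive, quasipositive, alternating, quasi-alternating, squeezed
and L-space knots, and knots concordant to a Whitehead double `D₊(J, t)` with `t < 2τ(J)`, are never partners.
[cite: OzsvathSzabo2003FourBallGenus, Thm. 1.1] -/
theorem crux_partner_not_isConcordant_of_blind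
    (hι : ∀ (K : Knot) (v : ℤ), K.IsHomotopyBallSlice → ι K v → v = 0)
    (hconc : ∀ {K K' : Knot} {v v' : ℤ}, ι K v → ι K' v' → K.IsConcordant K' → v = v')
    (hex : ∀ K : Knot, ∃ v, ι K v)
    {K K' K₀ : Knot} {Y : Type} [TopologicalSpace Y] [ChartedSpace (EuclideanSpace ℝ (Fin 3)) Y]
    (hK : IsIntegralSurgery (𝓡 3) Y K 0) (hK' : IsIntegralSurgery (𝓡 3) Y K' 0)
    (hsl : K.IsSmoothlySlice) {v : ℤ} (hv : ι K₀ v) (hv0 : v ≠ 0) : ¬ K'.IsConcordant K₀ :=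
  fun hc ↦ not_isSmoothlySlice_of_zeroSurgeryPair_of_isConcordant_of_blind hι hconc hex hK hK' hc hv hv0 hsl

/-- The friend lemma for `s` itself, GIVEN that `s` is blind (Q9.11, OPEN) and the concordance invariance of `s`
(named fact `HasRasmussenInvariant.eq_of_isConcordant`; existence of a Rasmussen invariant is the discharged
`Knot.exists_hasGaussDiagram_of_isIsotopic_holds`): a `0`-friend of a knot concordant to a knot with `s ≠ 0` is
not slice — the question attacked by Kegel–Spreer's Algorithm 6. [cite: Rasmussen2010, Thm. 1]
[cite: KegelSpreer2026, §6.3] -/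
theorem not_isSmoothlySlice_of_zeroSurgeryPair_of_isConcordant_of_mmsw911 (h911 : MMSW2023Question911Knot)
    (hC : HasRasmussenInvariant.eq_of_isConcordant)
    {K K' K₀ : Knot} {Y : Type} [TopologicalSpace Y] [ChartedSpace (EuclideanSpace ℝ (Fin 3)) Y]
    (hK : IsIntegralSurgery (𝓡 3) Y K 0) (hK' : IsIntegralSurgery (𝓡 3) Y K' 0)
    (hc : K'.IsConcordant K₀) {s : ℤ} (hs : K₀.HasRasmussenInvariant s) (hs0 : s ≠ 0) :
    ¬ K.IsSmoothlySlice :=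
  not_isSmoothlySlice_of_zeroSurgeryPair_of_isConcordant_of_blind
    (isHomotopyBallBlind_rasmussen_iff_mmsw2023Question911Knot.2 h911) (fun h h' hc ↦ hC h h' hc)
    (fun K ↦ by
      obtain ⟨K'', D, hK'', hD⟩ := Knot.exists_hasGaussDiagram_of_isIsotopic_holds K
      exact ⟨D.rasmussenInvariant, K'', D, hK'', hD, rfl⟩)
    hK hK' hc hs hs0

end Summit.SmoothPoincare4.SmoothPoincare4.Theorems.ZseCruxRasmussen.Negative

end
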